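import Literature.NumberTheory.EllipticCurves.TateCurve.NumberFieldUniformizationTwistedKernelOfReduction
import Literature.NumberTheory.EllipticCurves.TateCurve.UniformizationOneUnits
import HarnessLib

/-!
# Tate's twisted `v`-adic uniformisation and the kernel of reduction, BOTH WAYS:
# `E₁(K̄_v) = Ψ(1 + 𝔪)` at a place of multiplicative reduction (Silverman, *ATAEC* §V.4 «`φ(R₁^*) = E_{q,1}`»;
# theorems only)

Topic `Literature/NumberTheory/EllipticCurves/TateCurve`, namespace `Literature.NumberTheory.EllipticCurves.TateCurve`
(LEAD `bsd-wall-utd-p1` g26, crux r205 stmt-BirchSwinnertonDyer-24737 `TwinAlgMuZeroAtThree`, line `beta-road`;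
sequel to `NumberFieldUniformizationTwistedKernelOfReduction` (p763112, the inclusion `Ψ(1 + 𝔪) ⊆ E₁`) and
`UniformizationOneUnits` (the converse on the Tate model)).

For an elliptic curve `W` over a number field `K` (`K : Type`) with multiplicative reduction at `v` (split or
non-split): `q`, `t = √γ(W)`, and the twisted Tate parametrisation `Ψ : K̄_vˣ → E(K̄_v)` (surjective, kernel `q^ℤ`,
`σ • Ψ(u) = χ(σ) Ψ(σu)`) such that **a point of `E(K̄_v)` lies in the kernel of reduction `E₁(K̄_v)` iff it is `Ψ(u)`
for a principal unit `u`** (`|u − 1|_v < 1`). The new half (`E₁ ⊆ Ψ(1 + 𝔪)`): on the Tate model `E₁` is `|x| > 1`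
(the two integral models with unit `c₄` differ by `[u; r, s, t]` with `|u| = 1`, `|r| ≤ 1`), and a point of `E_q` with
`|x| > 1` is `φ(1 + t)`, `0 < |t| < 1` (ATAEC §V.4, Newton–Hensel on the one-units: tree `exists_tate_eq_of_one_lt_norm`,
packaged as `exists_oneUnit_tatePointAlg_eq_of_one_lt_norm`).

* **`exists_twistedTateUniformisation_localKernelOfReduction_iff`**.

Consumer: the identification of Greenberg's two local data at a multiplicative place — the Tate datum `Ψ(μ_{p^∞})`
(`X2.GreenbergVatsalTateDatum`, b2b) and the kernel-of-reduction datum `E[p^∞] ∩ E₁(K̄_v)`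
(`WeierstrassCurve.kernelOfReductionLocalDatum`, x9) — hence Greenberg LNM 1716 p. 76 `Im κ = Im λ` for the latter from
b2b's `imKummer_ge_strictCondition_multiplicative_holds`. BSD is not proved by any of this.

## References
* [SilvermanATAEC1994] J. H. Silverman, *Advanced Topics in the Arithmetic of Elliptic Curves*, GTM 151, Springer 1994,
  Thm. V.3.1 (c),(d), §V.4 (PDF pp. 399–401), Lemma V.5.2, Thm. V.5.3.
* [SilvermanAEC2009] J. H. Silverman, *The Arithmetic of Elliptic Curves*, 2nd ed., Prop. VII.1.3(d), Props. VII.2.1–2.2.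
-/

noncomputable section

open scoped Classical NNReal
open NumberField IsDedekindDomain WeierstrassCurve Field

namespace Literature.NumberTheory.EllipticCurves.TateCurve

open SteinWuthrich2013 Literature.NumberTheory.EllipticCurves
  Literature.NumberTheory.GaloisRepresentations IsDedekindDomain.HeightOneSpectrum

variable {K : Type} [Field K] [NumberField K] (W : WeierstrassCurve K) [W.IsElliptic]
  (v : HeightOneSpectrum (𝓞 K))

/-- **Silverman ATAEC Lemma V.5.2 (c) + Thm. V.5.3 AND §V.4 `φ(R₁^*) = E_{q,1}`, PROVED (split or non-split
multiplicative reduction)**: there are `q ∈ K_v` (`q ≠ 0`, `|q|_v < 1`), a square root `t ≠ 0` of `γ(W/K) = −c₄/c₆` in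
`K̄_v`, and a surjective homomorphism `Ψ : K̄_vˣ → E(K̄_v)` with kernel `q^ℤ` and the TWISTED equivariance
`σ • Ψ(u) = χ(σ) Ψ(σu)` (`χ(σ) = 1` iff `σ t = t`), such that **a point lies in the kernel of reduction `E₁(K̄_v)` IFF it is
`Ψ(u)` for a principal unit `u` (`|u − 1|_v < 1`)**.
[cite: SilvermanATAEC1994, Lemma V.5.2 (c), Thm. V.5.3 (PDF pp. 406–409), Thm. V.3.1 (c)(d), §V.4 (PDF pp. 399–401)]
[cite: SilvermanAEC2009, Prop. VII.1.3(d), Props. VII.2.1–2.2] -/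
theorem exists_twistedTateUniformisation_localKernelOfReduction_iff
    (hmult : W.HasMultiplicativeReductionAt v) :
    ∃ (q : v.adicCompletion K) (t : AlgebraicClosure (v.adicCompletion K))
      (Ψ : Additive (AlgebraicClosure (v.adicCompletion K))ˣ →+ localPoints W (v.adicCompletion K)),
      q ≠ 0 ∧ Valued.v q < 1 ∧ t ≠ 0 ∧
      t ^ 2 = algebraMap (v.adicCompletion K) (AlgebraicClosure (v.adicCompletion K))
        (algebraMap K (v.adicCompletion K) (-(W.c₄ / W.c₆))) ∧
      Function.Surjective Ψ ∧
      (∀ u : (AlgebraicClosure (v.adicCompletion K))ˣ, Ψ (Additive.ofMul u) = 0 ↔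
        ∃ n : ℤ, (u : AlgebraicClosure (v.adicCompletion K)) =
          algebraMap (v.adicCompletion K) (AlgebraicClosure (v.adicCompletion K)) q ^ n) ∧
      (∀ (σ : absoluteGaloisGroup (v.adicCompletion K))
          (u : (AlgebraicClosure (v.adicCompletion K))ˣ),
        σ • Ψ (Additive.ofMul u) =
          (if Field.absoluteGaloisGroup.toAlgEquiv (v.adicCompletion K) σ t = t then (1 : ℤ)
            else -1) •
          Ψ (Additive.ofMul (Units.map
            (Field.absoluteGaloisGroup.toAlgEquiv (v.adicCompletion K) σ :
              AlgebraicClosure (v.adicCompletion K) →* AlgebraicClosure (v.adicCompletion K))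
            u))) ∧
      (∀ P : localPoints W (v.adicCompletion K), P ∈ W.localKernelOfReduction v ↔
        ∃ u : (AlgebraicClosure (v.adicCompletion K))ˣ,
          v.spectralValuation ((u : AlgebraicClosure (v.adicCompletion K)) - 1) < 1 ∧
          Ψ (Additive.ofMul u) = P) := by
  letI := GaloisRepresentations.Ultrametric.AdicCompletion.nontriviallyNormedField K v
  haveI := charZero_adicCompletion' K v
  set L := AlgebraicClosure (v.adicCompletion K) with hL
  -- Step 1: `|j|_v > 1`, `c₄ c₆ ≠ 0`
  have hj := one_lt_norm_j_baseChange_of_hasMultiplicativeReductionAt W v hmult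
  obtain ⟨hc₄, hc₆⟩ := c₄_ne_zero_and_c₆_ne_zero_of_hasMultiplicativeReductionAt W v hmult
  -- Step 2: the Tate parameter and an isomorphism `C` over `K̄_v` (V.5.3 (a))
  obtain ⟨q, hq0, hq, hqj, C, hC⟩ :=
    isomorphic_tateCurve_of_one_lt_norm_j_holds (W.baseChange (v.adicCompletion K)) hj
  obtain ⟨hEc₄, hEc₆⟩ := tateCurve_c₄_ne_zero_and_c₆_ne_zero W v hq0 hq hqj hj
  -- the square root `t` of `γ(W)`
  obtain ⟨t, ht⟩ := IsAlgClosed.exists_pow_nat_eq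
    (algebraMap (v.adicCompletion K) (AlgebraicClosure (v.adicCompletion K))
      (algebraMap K (v.adicCompletion K) (-(W.c₄ / W.c₆)))) two_pos
  have ht0 : t ≠ 0 := by
    intro h
    have ht' := ht
    rw [h, zero_pow two_ne_zero, eq_comm, map_eq_zero, map_eq_zero, neg_eq_zero,
      div_eq_zero_iff] at ht'
    exact ht'.elim hc₄ hc₆
  -- `K̄_v` with the spectral norm, and Tate's EXPLICIT `φ(u) = (X(u,q), Y(u,q))`
  letI : NontriviallyNormedField L :=
    spectralNorm.nontriviallyNormedField (v.adicCompletion K) L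
  letI : NormedAlgebra (v.adicCompletion K) L := spectralNorm.normedAlgebra (v.adicCompletion K) L
  haveI : IsUltrametricDist L :=
    IsUltrametricDist.isUltrametricDist_of_isNonarchimedean_norm
      (isNonarchimedean_spectralNorm (K := v.adicCompletion K) (L := L))
  let φ : Additive Lˣ →+ geomPoints (tateCurve q) :=
    { toFun := fun a => tatePointAlg q (Additive.toMul a)
      map_zero' := tatePointAlg_of_eq_zpow (F := L) (q := q) 1 (n := 0) (by simp)
      map_add' := fun a b => by
        simp only [toMul_add]
        exact tatePointAlg_mul addRelX_eq_zero addRelY_eq_zero hq0 hq _ _ }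
  have hφ : ∀ u : Lˣ, φ (Additive.ofMul u) = tatePointAlg q u := fun _ => rfl
  have hsurj : Function.Surjective φ := by
    intro P
    obtain ⟨u, hu⟩ := tatePointAlg_surjective (F := L) addRelX_eq_zero addRelY_eq_zero hq0 hq P
    exact ⟨Additive.ofMul u, hu⟩
  have hker : ∀ u : Lˣ, φ (Additive.ofMul u) = 0 ↔
      ∃ n : ℤ, (u : L) = algebraMap (v.adicCompletion K) L q ^ n :=
    fun u => tatePointAlg_eq_zero_iff hq0 hq u
  have hequiv : ∀ (σ : absoluteGaloisGroup (v.adicCompletion K)) (u : Lˣ),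
      σ • φ (Additive.ofMul u) =
        φ (Additive.ofMul (Units.map
          (absoluteGaloisGroup.toAlgEquiv (v.adicCompletion K) σ : L →* L) u)) := by
    intro σ u
    rw [hφ, hφ]
    exact map_algEquiv_tatePointAlg hq0 hq (absoluteGaloisGroup.toAlgEquiv (v.adicCompletion K) σ) u
  -- the isomorphism of point groups `e = C`
  obtain ⟨e, he⟩ : ∃ e : localPoints W (v.adicCompletion K) ≃+ geomPoints (tateCurve q),
      ∀ P, e P = Affine.Point.congrEquiv hC (VariableChange.pointEquiv _ C
        (Affine.Point.congrEquiv (W.baseChange_baseChange_adicCompletion v).symm P)) :=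
    ⟨(Affine.Point.congrEquiv (W.baseChange_baseChange_adicCompletion v).symm).trans
      ((VariableChange.pointEquiv ((W.baseChange (v.adicCompletion K)).baseChange L) C).trans
        (Affine.Point.congrEquiv hC)), fun _ ↦ rfl⟩
  have hsign := smul_eq_sign_smul W v hc₄ hc₆ hq hEc₄ hEc₆ C hC ht e he
  -- `Ψ = C⁻¹ ∘ φ`
  refine ⟨q, t, e.symm.toAddMonoidHom.comp φ, hq0, ?_, ht0, ht, ?_, ?_, ?_, ?_⟩
  · exact (Valued.toNormedField.norm_lt_one_iff).mp hq
  · exact e.symm.surjective.comp hsurj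
  · intro u
    rw [← hker u]
    change e.symm (φ (Additive.ofMul u)) = 0 ↔ _
    rw [AddEquiv.map_eq_zero_iff]
  · -- twisted equivariance: `σ Ψ(u) = χ(σ) Ψ(σ u)`
    intro σ u
    change σ • e.symm (φ (Additive.ofMul u)) = _ • e.symm (φ _)
    rw [← hequiv σ u]
    have h1 := hsign σ (e.symm (φ (Additive.ofMul u)))
    rw [AddEquiv.apply_symm_apply] at h1
    apply e.injective
    rw [map_zsmul, AddEquiv.apply_symm_apply, h1, smul_smul]
    split_ifs <;> simp
  · -- §V.4: `E₁(K̄_v) = Ψ(1 + 𝔪)`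
    have hw := coe_spectralValuation v
    have hnorm : ∀ x : L, ‖x‖ = (v.spectralValuation x : ℝ) := fun x => by rw [hw]; rfl
    have hqL : ‖algebraMap (v.adicCompletion K) L q‖ < 1 := norm_algebraMap_lt_one hq
    have hqL0 : algebraMap (v.adicCompletion K) L q ≠ 0 := (map_ne_zero _).mpr hq0
    -- the chosen minimal model `Cv • W_v` at `v` and `D = (Cv ⊗ K̄_v) C⁻¹`: `|u_D| = 1`, `|r_D| ≤ 1`
    set Cv : VariableChange (v.adicCompletion K) :=
      ((W.baseChange (v.adicCompletion K)).exists_isMinimal (v.adicCompletionIntegers K)).choose with hCv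
    set D : VariableChange L := Cv.map (algebraMap (v.adicCompletion K) L) * C⁻¹ with hD
    have hmin : W.localMinimalModel v = Cv • W.baseChange (v.adicCompletion K) := rfl
    have hV : (W.localMinimalModel v).baseChange L = D • (tateCurve q).baseChange L := by
      rw [hD, mul_smul, ← hC, inv_smul_smul, hmin, WeierstrassCurve.baseChange,
        WeierstrassCurve.baseChange, ← map_variableChange]
      rfl
    have hX2 : (W.localMinimalIntegralModel v).map
        (algebraMap (v.adicCompletionIntegers K) (v.adicCompletion K)) = W.localMinimalModel v :=
      baseChange_integralModel_eq (v.adicCompletionIntegers K) (W.localMinimalModel v)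
    haveI hint₂ : ((W.localMinimalModel v).baseChange L).IsIntegral (v.spectralValuation).integer := by
      rw [← hX2]
      exact isIntegral_spectralValuation_baseChange hw (W.localMinimalIntegralModel v)
    haveI hintq : IsIntegral (v.adicCompletionIntegers K) (tateCurve q) :=
      tateCurve_isIntegral (v.adicCompletionIntegers K)
        (norm_le_one_iff_mem_range_adicCompletionIntegers K v) hq
    have hX1 : ((tateCurve q).integralModel (v.adicCompletionIntegers K)).map
        (algebraMap (v.adicCompletionIntegers K) (v.adicCompletion K)) = tateCurve q :=
      baseChange_integralModel_eq (v.adicCompletionIntegers K) (tateCurve q)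
    haveI hint₁ : ((tateCurve q).baseChange L).IsIntegral (v.spectralValuation).integer := by
      rw [← hX1]
      exact isIntegral_spectralValuation_baseChange hw
        ((tateCurve q).integralModel (v.adicCompletionIntegers K))
    have hc₄1 : v.spectralValuation ((tateCurve q).baseChange L).c₄ = 1 := by
      apply NNReal.coe_injective
      rw [WeierstrassCurve.baseChange, map_c₄, coe_spectralValuation_algebraMap hw, tateCurve_c₄,
        norm_tateE4_eq_one hq, NNReal.coe_one]
    have hc₄2 : v.spectralValuation ((W.localMinimalModel v).baseChange L).c₄ = 1 := by
      apply NNReal.coe_injective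
      rw [WeierstrassCurve.baseChange, map_c₄, coe_spectralValuation_algebraMap hw, NNReal.coe_one]
      exact (valuation_eq_one_iff_norm_eq_one (norm_le_one_iff_mem_range_adicCompletionIntegers K v)
        _).mp hmult.multiplicativeReduction
    have huD : v.spectralValuation (D.u : L) = 1 := by
      have h := hc₄2
      rw [hV, variableChange_c₄, map_mul, map_pow, hc₄1, mul_one, Units.val_inv_eq_inv_val,
        map_inv₀, inv_pow, inv_eq_one] at h
      exact (pow_eq_one_iff_of_nonneg zero_le four_ne_zero).mp h
    have hrD : v.spectralValuation D.r ≤ 1 :=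
      val_r_le_one_of_isIntegral (V₁ := (tateCurve q).baseChange L)
        (V₂ := (W.localMinimalModel v).baseChange L) hV huD.le
    have hfac : Cv.map (algebraMap (v.adicCompletion K) L) = D * C := by
      rw [hD, inv_mul_cancel_right]
    -- KEY: for a finite point `(x, y)` of `W ⊗ K̄_v`: `(x, y) ∈ E₁ ↔ |C.toX x| > 1`, and `e (x, y) = (C.toX x, C.toY x y)`
    have hcoord : ∀ (x y : L) (hxy : (W.baseChange L).toAffine.Nonsingular x y), ∃ h',
        e (show localPoints W (v.adicCompletion K) from .some x y hxy) = .some (C.toX x) (C.toY x y) h' := by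
      intro x y hxy
      have step := he (show localPoints W (v.adicCompletion K) from .some x y hxy)
      rw [Affine.Point.congrEquiv_some, VariableChange.pointEquiv_some, Affine.Point.congrEquiv_some] at step
      exact ⟨_, step⟩
    have hkey : ∀ (x y : L) (hxy : (W.baseChange L).toAffine.Nonsingular x y),
        (show localPoints W (v.adicCompletion K) from .some x y hxy) ∈ W.localKernelOfReduction v ↔
          1 < ‖C.toX x‖ := by
      intro x y hxy
      have hQ : W.localPointsEquivModel v (show localPoints W (v.adicCompletion K) from .some x y hxy) =
          .some ((Cv.map (algebraMap (v.adicCompletion K) L)).toX x)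
            ((Cv.map (algebraMap (v.adicCompletion K) L)).toY x y) ?_ := by
        rw [localPointsEquivModel_apply, localPointsEquivPoint_apply]
        change Affine.Point.congrEquiv _ (VariableChange.pointEquivBaseChange _ _ _
          (Affine.Point.congrEquiv _ (.some x y hxy))) = _
        rw [Affine.Point.congrEquiv_some, VariableChange.pointEquivBaseChange_some,
          Affine.Point.congrEquiv_some]
      rw [W.mem_localKernelOfReduction_iff_of_eq_some v hQ, hfac, VariableChangeAux.toX_mul,
        VariableChange.one_lt_v_toX_iff _ huD hrD, ← NNReal.coe_lt_coe, NNReal.coe_one, ← hnorm]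
    intro P
    constructor
    · -- `E₁ ⊆ Ψ(1 + 𝔪)`
      intro hP
      change (W.baseChange L).toAffine.Point at P
      rcases hPc : P with _ | ⟨x, y, hxy⟩
      · refine ⟨1, by rw [Units.val_one, sub_self, map_zero]; exact zero_lt_one, ?_⟩
        change e.symm (φ (Additive.ofMul 1)) = _
        rw [ofMul_one, map_zero, map_zero]
        rfl
      · rw [hPc] at hP
        have hX := (hkey x y hxy).mp hP
        obtain ⟨h', he'⟩ := hcoord x y hxy
        obtain ⟨u, hu1, hu⟩ := exists_oneUnit_tatePointAlg_eq_of_one_lt_norm (F := L) hq0 hq h' hX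
        refine ⟨u, by rw [← NNReal.coe_lt_coe, NNReal.coe_one, ← hnorm]; exact hu1, ?_⟩
        change e.symm (φ (Additive.ofMul u)) = _
        rw [hφ, hu, ← he', AddEquiv.symm_apply_apply]
    · -- `Ψ(1 + 𝔪) ⊆ E₁`
      rintro ⟨u, hu1, rfl⟩
      change e.symm (φ (Additive.ofMul u)) ∈ W.localKernelOfReduction v
      rw [hφ]
      by_cases h1 : (u : L) = 1
      · have h0 : tatePointAlg q u = 0 :=
          tatePointAlg_of_eq_zpow u (n := 0) (by rw [h1, zpow_zero])
        rw [h0]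
        change e.symm (0 : geomPoints (tateCurve q)) ∈ W.localKernelOfReduction v
        rw [map_zero]
        exact AddSubgroup.zero_mem _
      · set s : L := (u : L) - 1 with hs_def
        have hs0 : s ≠ 0 := fun h => h1 (sub_eq_zero.mp h)
        have hs : ‖s‖ < 1 := by
          rw [hnorm, ← NNReal.coe_one, NNReal.coe_lt_coe]; exact hu1
        have hus : (u : L) = 1 + s := by rw [hs_def]; ring
        have hunorm : ‖(u : L)‖ = 1 := by rw [hus]; exact norm_one_add_eq_one hs
        have hu' : ∀ n : ℤ, (u : L) ≠ algebraMap (v.adicCompletion K) L q ^ n := by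
          intro n hn
          have hn1 : ‖algebraMap (v.adicCompletion K) L q‖ ^ n = 1 := by
            rw [← norm_zpow, ← hn, hunorm]
          rcases lt_trichotomy n 0 with hneg | rfl | hpos
          · exact absurd hn1 (ne_of_gt (one_lt_zpow_of_neg₀ (norm_pos_iff.mpr hqL0) hqL hneg))
          · exact h1 (by rw [hn, zpow_zero])
          · exact absurd hn1 (ne_of_lt (zpow_lt_one₀ (norm_pos_iff.mpr hqL0) hqL hpos))
        have hPt : tatePointAlg q u = .some _ _ (nonsingular_tate_alg hq0 hq u hu') :=
          tatePointAlg_of_ne_zpow hq0 hq u hu'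
        have hX : 1 < ‖tateX (algebraMap (v.adicCompletion K) L q) (u : L)‖ := by
          rw [hus, norm_tateX_one_add_of_isAlgebraic hq hs0 hs]
          have : 1 < ‖s‖⁻¹ := one_lt_inv_iff₀.mpr ⟨norm_pos_iff.mpr hs0, hs⟩
          nlinarith
        set P : localPoints W (v.adicCompletion K) := e.symm (tatePointAlg q u) with hP_def
        have heP : e P = tatePointAlg q u := by rw [hP_def, AddEquiv.apply_symm_apply]
        change (W.baseChange L).toAffine.Point at P
        rcases hPc : P with _ | ⟨x, y, hxy⟩
        · exact AddSubgroup.zero_mem _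
        · have hXeq : C.toX x = tateX (algebraMap (v.adicCompletion K) L q) (u : L) := by
            have h2 : e (show localPoints W (v.adicCompletion K) from .some x y hxy) = tatePointAlg q u := by
              rw [← hPc]; exact heP
            obtain ⟨h', he'⟩ := hcoord x y hxy
            rw [he', hPt] at h2
            exact ((Affine.Point.some.injEq _ _ _ _ _ _).mp h2).1
          exact (hkey x y hxy).mpr (by rw [hXeq]; exact hX)

end Literature.NumberTheory.EllipticCurves.TateCurve

end
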